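/-
Copyright (c) 2026. All rights reserved.
Released under Apache 2.0 license as described in the file LICENSE.
Authors: abc-iut cell, seat abc-iut-L4-t10 (gen 2; row C45-M0 of plan/L4/SUBDAG-AbsTopIII-Cor45.md:
the MODEL of [AbsTopIII] Cor 4.5 — Def 4.1 (iii) at category level, part 1/3).
-/
import Literature.AnabelianGeometry.AbsoluteAnabelian.ArchimedeanUnivCover
import Mathlib.Analysis.Calculus.Deriv.Comp
import Mathlib.Analysis.SpecialFunctions.ExpDeriv
import Mathlib.Analysis.Normed.Module.Connected
import Mathlib.LinearAlgebra.Complex.FiniteDimensional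
import HarnessLib

/-!
# [AbsTopIII] Def 4.1: the functoriality of Cor 2.7 (e) as an interface, and holomorphic local
# isomorphisms between arithmetic data presented inside CAFs

S. Mochizuki, *Topics in absolute anabelian geometry III*, §4, Def 4.1 (i)–(iii) pp. 101–103 of the
author's kurims manuscript (lit key `paper:url-5493eb38cbb7`, read on the page; bib key
`MochizukiAbsTopIII2015`).  First of three files (`ArchimedeanHolCategories`, `ArchimedeanHolPairs`,
`ArchimedeanLogFrobeniusModel`) building the MODEL of Cor 4.5 — the categories `𝒞^hol_TF`, `EA`,
`𝒞^hol_TH`, `LinHol` and the functors `log`, `λ^×`, `λ^∼`, `ι_log`, `ι_×`, `κ_LH`, `φ_LH`, `η_LH` of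
Def 4.1 (iii)–(v) / Cor 4.5 (ii) — as REAL Mathlib categories and functors, i.e. what
`ArchimedeanLogFrobenius.lean` / `ArchimedeanLogFrobeniusFunctors.lean` (seats abc-iut-L4-t2 /
abc-iut-L4-t14: Def 4.1 at OBJECT level) record as not typed ("the packaging of `𝒞^hol_T` … and of
`TH ⊇ EA ⊇ EA_sB` as Mathlib categories") and what every morphism of pairs there carries as FREE data
("the homomorphism `𝒜_𝕏₁ → 𝒜_𝕏₂` standing for the one induced by `φ_𝕏` (functoriality of Cor 2.7 in
finite étale morphisms)").

## The one interface: Cor 2.7 (e) together with its functoriality (`AutHolFieldFunctor`)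

Def 4.1 (i) p. 101: "`𝒜_𝕏_ell := 𝒜_𝕏_ell ∪ {0}` — where we write `𝒜_𝕏_ell` for the '`𝒜_p`' of Corollary
2.7, (e) [equipped with various topological and algebraic structures], which may be identified [hence
considered as an object that is independent of '`p`'] via the various isomorphisms '`𝒜_p ⥲ 𝒜_{p'}`' of
Corollary 2.7, (e), together with the functoriality of the algorithms of Corollary 2.7"; Def 4.1 (iii)
p. 103: "we shall write `TH ⊇ EA ⊇ EA_sB` for the subcategories determined, respectively, by the
elliptically admissible hyperbolic orbicurves over CAF's and the finite étale morphisms …"; Def 4.1 (v)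
/ Cor 4.5: "all of which is to be understood as constructed via the algorithms of Corollary 2.7", "the
functorial algorithms of Corollary 2.7".  The reconstruction algorithms of Cor 2.7 are a DEEP INPUT of
the campaign (L4 typing policy θ: interface structures whose fields quote print); accordingly the model
is written over ONE structure `𝔄 : AutHolFieldFunctor` recording exactly: the category `EA` (objects:
elliptically admissible Aut-holomorphic orbispaces; morphisms: finite étale morphisms), for each object
`𝕏` the topological field `𝒜_𝕏 ∪ {0}` — a CAF (tree `IsCAF`, [AbsTopIII] §0) — and for each finite
étale `φ : 𝕏 → 𝕐` the INDUCED isomorphism of topological fields `𝒜_φ : 𝒜_𝕏 ⥲ 𝒜_𝕐`, functorially.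
Instantiating `𝔄` on the tree's concrete carriers (`AutHolOrbiPresentation`, `LocalLinearHolStructure`,
`LinHolField` of `HolomorphicCores.lean` / `ArchimedeanLogFrobenius.lean`) IS the construction of the
Cor 2.7 algorithms and is not done here; for such an instance an object of `HolTFPair 𝔄`
(`ArchimedeanHolPairs.lean`) is literally the data `(k, 𝕏, κ_k)` of abc-iut-L4-t14's
`ModelAutHolPair .TF`.

## Also here: holomorphic local isomorphisms in coordinates (`IsHolLocIso`)

The morphisms of `𝒞^hol_TH` (Def 4.1 (ii): "a morphism of objects of `TH`" — of Aut-holomorphic spaces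
— "compatible [relative to the respective Kummer structures]", these being co-holomorphicizations,
Def 4.1 (i)/(iv)) are typed, for arithmetic data presented inside CAFs, as maps that are holomorphic
with nowhere-vanishing derivative when source and target are read in `ℂ` through the Kummer charts:
`coordRep`, `IsHolLocIso` and its three generators used by the model — chart-identity maps
(`of_eq_id`: inclusions `(k~)^× ↪ k~`, restrictions of structure isomorphisms), the exponential
(`of_eq_exp`: the universal covering `k~ ↠ k^×`), and composition (`comp`).  Finally
`IsCAF.isConnected_ne_zero`: `k^× = k ∖ {0}` is connected ("connected Aut-holomorphic [spaces]",
Def 4.1 (i)).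

Refereed pre-IUT anabelian geometry; a MODEL (kernel definitions) over a named interface, not a
discharge of Cor 2.7; nothing here bears on [IUTchIII] Cor. 3.12; typed ≠ discharged.
-/

set_option autoImplicit false

noncomputable section

namespace Literature.AnabelianGeometry.AbsoluteAnabelian

open _root_.CategoryTheory _root_.Topology

universe u

/-! ### The interface: `EA` and the functor `𝕏 ↦ 𝒜_𝕏` of Cor 2.7 (e) -/

/-- **Cor 2.7 (e) with its functoriality, as used by Def 4.1 / Cor 4.5** (INTERFACE; the
reconstruction algorithms themselves are not constructed): the category `EA` — "the subcategor[y of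
`TH`] determined … by the elliptically admissible hyperbolic orbicurves over CAF's and the finite étale
morphisms" (Def 4.1 (iii) p. 103) —, for each object `𝕏` the topological field
"`𝒜_𝕏 := 𝒜_𝕏 ∪ {0}` … the '`𝒜_p`' of Corollary 2.7, (e) [equipped with various topological and algebraic
structures]" (Def 4.1 (i) p. 101), a CAF, and for each finite étale `φ : 𝕏 → 𝕐` the induced isomorphism
of topological fields `𝒜_𝕏 ⥲ 𝒜_𝕐` ("identified … via the various isomorphisms '`𝒜_p ⥲ 𝒜_{p'}`' of
Corollary 2.7, (e), together with the functoriality of the algorithms of Corollary 2.7"), compatible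
with identities and composition.  The field `𝒜_𝕏` is carried as a normed field (as in
`ArchimedeanLogFrobenius.LinHolField`); only its topological field structure is used.
[cite: MochizukiAbsTopIII2015, Definition 4.1 (i) p.101] -/
structure AutHolFieldFunctor : Type (u + 2) where
  /-- The category `EA` (objects: elliptically admissible Aut-holomorphic orbispaces; morphisms: finite
  étale morphisms of Aut-holomorphic orbispaces). -/
  EA : Type (u + 1)
  [cat : Category.{u + 1} EA]
  /-- `𝒜_𝕏 ∪ {0}`, the topological field reconstructed by Cor 2.7 (e). -/
  A : EA → Type u
  [normedField : ∀ X, NormedField (A X)]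
  /-- `𝒜_𝕏 ∪ {0}` is a CAF ("isomorphisms of topological groups `ℂ^× ⥲ 𝒜_p` … compatible with the
  topological field structures", Cor 2.7 (e)). -/
  isCAF : ∀ X, IsCAF (A X)
  /-- The isomorphism `𝒜_𝕏 ⥲ 𝒜_𝕐` induced by a finite étale morphism `𝕏 → 𝕐`. -/
  Amap : ∀ {X Y : EA}, (X ⟶ Y) → (A X ≃+* A Y)
  continuous_Amap : ∀ {X Y : EA} (f : X ⟶ Y), Continuous (Amap f)
  continuous_Amap_symm : ∀ {X Y : EA} (f : X ⟶ Y), Continuous (Amap f).symm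
  /-- Functoriality of the algorithms of Cor 2.7: identities … -/
  Amap_id : ∀ X : EA, Amap (𝟙 X) = RingEquiv.refl (A X)
  /-- … and composition. -/
  Amap_comp : ∀ {X Y Z : EA} (f : X ⟶ Y) (g : Y ⟶ Z), Amap (f ≫ g) = (Amap f).trans (Amap g)

attribute [instance] AutHolFieldFunctor.cat AutHolFieldFunctor.normedField

namespace AutHolFieldFunctor

variable (𝔄 : AutHolFieldFunctor.{u})

/-- `𝒜` of an identity is the identity, pointwise. [cite: MochizukiAbsTopIII2015, Definition 4.1 (i) p.101] -/
@[simp] theorem Amap_id_apply (X : 𝔄.EA) (a : 𝔄.A X) : 𝔄.Amap (𝟙 X) a = a := by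
  rw [𝔄.Amap_id]; rfl

/-- `𝒜` of a composite is the composite, pointwise. [cite: MochizukiAbsTopIII2015, Definition 4.1 (i) p.101] -/
@[simp] theorem Amap_comp_apply {X Y Z : 𝔄.EA} (f : X ⟶ Y) (g : Y ⟶ Z) (a : 𝔄.A X) :
    𝔄.Amap (f ≫ g) a = 𝔄.Amap g (𝔄.Amap f a) := by
  rw [𝔄.Amap_comp]; rfl

/-- `𝒜_𝕏` has characteristic zero (it is a CAF). [cite: MochizukiAbsTopIII2015, Definition 4.1 (i) p.101] -/
theorem charZero_A (X : 𝔄.EA) : CharZero (𝔄.A X) := (𝔄.isCAF X).charZero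

end AutHolFieldFunctor

/-! ### Holomorphic local isomorphisms between subsets of CAFs, in coordinates -/

section Coordinates

variable {k₁ k₂ k₃ : Type u}

/-- The coordinate expression of a map `φ : S → k₂` (`S ⊆ k₁`) in charts `u₁ : k₁ → ℂ`, `u₂ : k₂ → ℂ`:
the function `ℂ → ℂ` equal to `u₂ ∘ φ ∘ u₁⁻¹` on `u₁(S)` (and `0` elsewhere).
[cite: MochizukiAbsTopIII2015, Definition 4.1 (ii) p.102] -/
def coordRep (u₁ : k₁ → ℂ) (u₂ : k₂ → ℂ) (S : Set k₁) (φ : S → k₂) : ℂ → ℂ :=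
  Function.extend (fun x : S => u₁ x) (fun x => u₂ (φ x)) 0

/-- On `u₁(S)` the coordinate expression is `u₂ ∘ φ ∘ u₁⁻¹`. [cite: MochizukiAbsTopIII2015, Definition 4.1 (ii) p.102] -/
theorem coordRep_apply {u₁ : k₁ → ℂ} (hu₁ : Function.Injective u₁) (u₂ : k₂ → ℂ) (S : Set k₁)
    (φ : S → k₂) (x : S) : coordRep u₁ u₂ S φ (u₁ x) = u₂ (φ x) := by
  have hinj : Function.Injective (fun x : S => u₁ x) :=
    fun a b h => Subtype.ext (hu₁ h)
  exact hinj.extend_apply _ _ x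

/-- **A holomorphic local isomorphism in coordinates**: the coordinate expression of `φ : S → k₂` in
the charts `u₁`, `u₂` is `ℂ`-differentiable on `u₁(S)` with nowhere-vanishing derivative there — the
typed form of "a [local iso]morphism of Aut-holomorphic spaces compatible with the
co-holomorphicizations" for arithmetic data presented inside CAFs (see the module docstring).
[cite: MochizukiAbsTopIII2015, Definition 4.1 (ii) p.102] -/
def IsHolLocIso (u₁ : k₁ → ℂ) (u₂ : k₂ → ℂ) (S : Set k₁) (φ : S → k₂) : Prop :=
  DifferentiableOn ℂ (coordRep u₁ u₂ S φ) (u₁ '' S) ∧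
    ∀ z ∈ u₁ '' S, deriv (coordRep u₁ u₂ S φ) z ≠ 0

/-- Criterion: if the coordinate expression of `φ` agrees on `u₁(S)` with a function `g` holomorphic
with nowhere-vanishing derivative on the open set `u₁(S)`, then `φ` is a holomorphic local isomorphism
in coordinates. [cite: MochizukiAbsTopIII2015, Definition 4.1 (ii) p.102] -/
theorem IsHolLocIso.of_eq {u₁ : k₁ → ℂ} (hu₁ : Function.Injective u₁) {u₂ : k₂ → ℂ} {S : Set k₁}
    (hS : IsOpen (u₁ '' S)) {φ : S → k₂} (g : ℂ → ℂ) (hg : DifferentiableOn ℂ g (u₁ '' S))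
    (hg' : ∀ z ∈ u₁ '' S, deriv g z ≠ 0) (heq : ∀ x : S, u₂ (φ x) = g (u₁ x)) :
    IsHolLocIso u₁ u₂ S φ := by
  have hEq : Set.EqOn (coordRep u₁ u₂ S φ) g (u₁ '' S) := by
    rintro _ ⟨x, hx, rfl⟩
    rw [coordRep_apply hu₁ u₂ S φ ⟨x, hx⟩, heq]
  refine ⟨hg.congr hEq, fun z hz => ?_⟩
  have hev : coordRep u₁ u₂ S φ =ᶠ[𝓝 z] g :=
    Filter.eventuallyEq_of_mem (hS.mem_nhds hz) hEq
  rw [hev.deriv_eq]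
  exact hg' z hz

/-- Maps whose coordinate expression is the identity (inclusions of open subsets, restrictions of the
structure isomorphisms) are holomorphic local isomorphisms in coordinates.
[cite: MochizukiAbsTopIII2015, Definition 4.1 (ii) p.102] -/
theorem IsHolLocIso.of_eq_id {u₁ : k₁ → ℂ} (hu₁ : Function.Injective u₁) {u₂ : k₂ → ℂ} {S : Set k₁}
    (hS : IsOpen (u₁ '' S)) {φ : S → k₂} (heq : ∀ x : S, u₂ (φ x) = u₁ x) :
    IsHolLocIso u₁ u₂ S φ :=
  IsHolLocIso.of_eq hu₁ hS id differentiableOn_id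
    (fun z _ => by rw [deriv_id]; exact one_ne_zero) heq

/-- Maps whose coordinate expression is the complex exponential (the universal covering `k~ ↠ k^×`)
are holomorphic local isomorphisms in coordinates. [cite: MochizukiAbsTopIII2015, Definition 4.1 (i) p.101] -/
theorem IsHolLocIso.of_eq_exp {u₁ : k₁ → ℂ} (hu₁ : Function.Injective u₁) {u₂ : k₂ → ℂ} {S : Set k₁}
    (hS : IsOpen (u₁ '' S)) {φ : S → k₂} (heq : ∀ x : S, u₂ (φ x) = Complex.exp (u₁ x)) :
    IsHolLocIso u₁ u₂ S φ :=
  IsHolLocIso.of_eq hu₁ hS Complex.exp Complex.differentiable_exp.differentiableOn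
    (fun z _ => by rw [Complex.deriv_exp]; exact Complex.exp_ne_zero z) heq

/-- **Composition** of holomorphic local isomorphisms in coordinates (matching middle chart).
[cite: MochizukiAbsTopIII2015, Definition 4.1 (ii) p.102] -/
theorem IsHolLocIso.comp {u₁ : k₁ → ℂ} {u₂ : k₂ → ℂ} {u₃ : k₃ → ℂ} (hu₁ : Function.Injective u₁)
    (hu₂ : Function.Injective u₂) {S : Set k₁} {T : Set k₂} (hS : IsOpen (u₁ '' S))
    (hT : IsOpen (u₂ '' T)) {φ : S → k₂} {ψ : T → k₃} (hφ : IsHolLocIso u₁ u₂ S φ)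
    (hψ : IsHolLocIso u₂ u₃ T ψ) (hmem : ∀ x : S, φ x ∈ T) :
    IsHolLocIso u₁ u₃ S (fun x => ψ ⟨φ x, hmem x⟩) := by
  set g₁ := coordRep u₁ u₂ S φ with hg₁
  set g₂ := coordRep u₂ u₃ T ψ with hg₂
  have hmaps : Set.MapsTo g₁ (u₁ '' S) (u₂ '' T) := by
    rintro _ ⟨x, hx, rfl⟩
    rw [hg₁, coordRep_apply hu₁ u₂ S φ ⟨x, hx⟩]
    exact ⟨φ ⟨x, hx⟩, hmem ⟨x, hx⟩, rfl⟩
  have hval : ∀ x : S, g₂ (g₁ (u₁ x)) = u₃ (ψ ⟨φ x, hmem x⟩) := by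
    intro x
    rw [hg₁, coordRep_apply hu₁ u₂ S φ x, hg₂, coordRep_apply hu₂ u₃ T ψ ⟨φ x, hmem x⟩]
  refine IsHolLocIso.of_eq hu₁ hS (g₂ ∘ g₁) (hψ.1.comp hφ.1 hmaps) (fun z hz => ?_)
    (fun x => (hval x).symm)
  have h₁ : DifferentiableAt ℂ g₁ z := hφ.1.differentiableAt (hS.mem_nhds hz)
  have h₂ : DifferentiableAt ℂ g₂ (g₁ z) := hψ.1.differentiableAt (hT.mem_nhds (hmaps hz))
  rw [deriv_comp z h₂ h₁]
  exact mul_ne_zero (hψ.2 _ (hmaps hz)) (hφ.2 z hz)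

end Coordinates

/-! ### Topological-field isomorphisms as homeomorphisms (bookkeeping) -/

section Bicontinuous

variable {k₁ k₂ : Type*} [NormedField k₁] [NormedField k₂]

/-- A bicontinuous ring isomorphism as a homeomorphism. [folklore] -/
def ringEquivHomeomorph (e : k₁ ≃+* k₂) (he : Continuous e) (he' : Continuous e.symm) : k₁ ≃ₜ k₂ where
  toEquiv := e.toEquiv
  continuous_toFun := he
  continuous_invFun := he'

end Bicontinuous

/-! ### The two arithmetic data `k^×`, `k~` of Def 4.1 (iv) are connected -/

/-- `k ∖ {0}` is connected for a CAF `k` (image of `ℂ ∖ {0}`). [cite: MochizukiAbsTopIII2015, Definition 4.1 (i) p.101] -/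
theorem IsCAF.isConnected_ne_zero {k : Type u} [NormedField k] (hk : IsCAF k) :
    IsConnected {x : k | x ≠ 0} := by
  obtain ⟨e, he, he'⟩ := hk.exists_equiv
  have hC : IsConnected ({0}ᶜ : Set ℂ) :=
    isConnected_compl_singleton_of_one_lt_rank (by simp [Complex.rank_real_complex]) 0
  have himg : (fun z : ℂ => e.symm z) '' ({0}ᶜ : Set ℂ) = {x : k | x ≠ 0} := by
    ext x
    simp only [Set.mem_image, Set.mem_compl_iff, Set.mem_singleton_iff, Set.mem_setOf_eq]
    constructor
    · rintro ⟨z, hz, rfl⟩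
      exact (map_ne_zero_iff _ e.symm.injective).mpr hz
    · intro hx
      exact ⟨e x, (map_ne_zero_iff _ e.injective).mpr hx, e.symm_apply_apply x⟩
  rw [← himg]
  exact hC.image _ he'.continuousOn
end Literature.AnabelianGeometry.AbsoluteAnabelian

end
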